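import Summits.ValiantsHypothesis.ValiantsHypothesis.Theorems.PolyaContinuedMonotoneCoverHardBalExPure

/-!
# Crux `MonotoneCoverHard` (stmt-ValiantsHypothesis-7421), width line — «three hard lanes», part 1:
specialising the permanent to three label-rows, and matchings with equal permutation labels

Tools for the kernel proof of val-width-7421-p2's CALIBRATION §F conjecture «a label-bijective cover
of `per_n`, `n ≥ 3`, in which three rows carry a variable edge in every weight-nonzero matching with
FIXED label-rows (three hard lanes) is not Pfaffian» (val-width-7421-p3 g0, 2026-08-27; assembly in
`…HardLanes.lean`).

* `aeval_perPoly_specialize` — LAPLACE SPECIALISATION of the generic permanent: for an injection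
  `e : Fin r → Fin n` of label-rows and a permutation `σ₀` of `Fin n`, the substitution
  `x_{e t, σ₀ (e t')} ↦ X (t, t')`, `x_{e t, l} ↦ 0` otherwise, `x_{k, σ₀ k} ↦ 1`, `x_{k, l} ↦ 0`
  otherwise (`k ∉ range e`) sends `per_n` to `per_r`: only the permutations that agree with `σ₀` off
  `range e` survive, and they are the `σ₀ ∘ (β extended along e)`, `β ∈ S_r`;
* `eq_of_perm_labels_eq` — two weight-nonzero perfect matchings of a cover of `per_n` whose variable
  labels lie on the graph of the SAME permutation `σ` of `Fin n` are equal (label-injectivity,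
  val-width-7421-p1's `label_bijection`).

VP ≠ VNP is not moved.  No definitions.
-/

namespace Summit.ValiantsHypothesis.ValiantsHypothesis.Theorems.PolyaContinuedMonotoneCoverHard

-- summit = sub-problem name (single-conjunct summit, D-0017 layout), so the namespace repeats it
set_option linter.dupNamespace false

open scoped Classical
open Finset
open Summit.ValiantsHypothesis.ValiantsHypothesis.Theorems.PolyaContinued.MonotoneCoverHardRectangle
  (exists_labels aeval_permanent_cover perPoly_eq_sum_monomial label_bijection pexp_injective
    pexp_apply)

/-- The generic permanent as a sum of products of variables. -/
theorem perPoly_eq_sum_prod (n : ℕ) :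
    Literature.Computability.AlgebraicComplexity.perPoly (Fin n) ℂ =
      ∑ σ : Equiv.Perm (Fin n), ∏ i, (MvPolynomial.X (i, σ i) : MvPolynomial (Fin n × Fin n) ℂ) := by
  unfold Literature.Computability.AlgebraicComplexity.perPoly
  rw [← Matrix.permanent_transpose]
  simp only [Matrix.permanent, Matrix.transpose_apply, Matrix.mvPolynomialX_apply]

/-- **Laplace specialisation of the permanent.**  Substituting, for an injection `e : Fin r → Fin n`
and a permutation `σ₀`, `x_{e t, σ₀ (e t')} ↦ X (t, t')`, the other variables of the rows `e t` by `0`,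
`x_{k, σ₀ k} ↦ 1` and the other variables of the rows `k ∉ range e` by `0`, turns `per_n` into
`per_r`. -/
theorem aeval_perPoly_specialize {n r : ℕ} (e : Fin r → Fin n) (he : Function.Injective e)
    (σ₀ : Equiv.Perm (Fin n)) (f : Fin n × Fin n → MvPolynomial (Fin r × Fin r) ℂ)
    (hf1 : ∀ t t', f (e t, σ₀ (e t')) = MvPolynomial.X (t, t'))
    (hf2 : ∀ t l, (∀ t', l ≠ σ₀ (e t')) → f (e t, l) = 0)
    (hf3 : ∀ k, (∀ t, k ≠ e t) → f (k, σ₀ k) = 1)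
    (hf4 : ∀ k l, (∀ t, k ≠ e t) → l ≠ σ₀ k → f (k, l) = 0) :
    MvPolynomial.aeval f (Literature.Computability.AlgebraicComplexity.perPoly (Fin n) ℂ) =
      Literature.Computability.AlgebraicComplexity.perPoly (Fin r) ℂ := by
  rw [perPoly_eq_sum_prod, perPoly_eq_sum_prod, map_sum]
  simp only [map_prod, MvPolynomial.aeval_X]
  -- the embedding `β ↦ σ₀ ∘ (β extended along e)` of `S_r` into `S_n`
  set ι : Fin r ≃ Set.range e := Equiv.ofInjective e he with hι
  have hιe : ∀ t, ((ι t : Set.range e) : Fin n) = e t := fun t => by simp [hι]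
  set emb : Equiv.Perm (Fin r) → Equiv.Perm (Fin n) := fun β => σ₀ * β.extendDomain ι with hemb
  have hemb1 : ∀ β t, emb β (e t) = σ₀ (e (β t)) := by
    intro β t
    rw [hemb]
    simp only [Equiv.Perm.mul_apply]
    rw [← hιe t, Equiv.Perm.extendDomain_apply_image, hιe]
  have hemb2 : ∀ β k, (∀ t, k ≠ e t) → emb β k = σ₀ k := by
    intro β k hk
    rw [hemb]
    simp only [Equiv.Perm.mul_apply]
    rw [Equiv.Perm.extendDomain_apply_not_subtype]
    rintro ⟨t, ht⟩
    exact hk t ht.symm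
  have hemb_inj : Function.Injective emb := by
    intro β₁ β₂ h
    ext t
    have h1 := congrArg (fun σ : Equiv.Perm (Fin n) => σ (e t)) h
    simp only [hemb1] at h1
    exact congrArg Fin.val (he (σ₀.injective h1))
  -- products vanish off the image of `emb`
  have key : ∀ σ : Equiv.Perm (Fin n), (∏ i, f (i, σ i)) ≠ 0 → ∃ β, σ = emb β := by
    intro σ hσ
    have hne : ∀ i, f (i, σ i) ≠ 0 := fun i => (Finset.prod_ne_zero_iff.1 hσ) i (mem_univ i)
    have hoff : ∀ k, (∀ t, k ≠ e t) → σ k = σ₀ k := by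
      intro k hk
      by_contra h
      exact hne k (hf4 k (σ k) hk h)
    have hon : ∀ t, ∃ t', σ (e t) = σ₀ (e t') := by
      intro t
      by_contra h
      refine hne (e t) (hf2 t (σ (e t)) fun t' ht' => h ⟨t', ht'⟩)
    choose b hb using hon
    have hbinj : Function.Injective b := by
      intro t₁ t₂ h
      have : σ (e t₁) = σ (e t₂) := by rw [hb t₁, hb t₂, h]
      exact he (σ.injective this)
    refine ⟨Equiv.ofBijective b ⟨hbinj, Finite.surjective_of_injective hbinj⟩, ?_⟩
    ext k
    by_cases hk : ∃ t, k = e t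
    · obtain ⟨t, rfl⟩ := hk
      rw [hemb1, hb t]
      rfl
    · have hk' : ∀ t, k ≠ e t := fun t ht => hk ⟨t, ht⟩
      rw [hoff k hk', hemb2 _ k hk']
  -- the product along `emb β`
  have hval : ∀ β : Equiv.Perm (Fin r), (∏ i, f (i, emb β i)) =
      ∏ t, (MvPolynomial.X (t, β t) : MvPolynomial (Fin r × Fin r) ℂ) := by
    intro β
    have h1 : (∏ i, f (i, emb β i)) = ∏ i ∈ univ.image e, f (i, emb β i) := by
      refine (Finset.prod_subset (subset_univ _) fun k _ hk => ?_).symm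
      have hk' : ∀ t, k ≠ e t := fun t ht => hk (mem_image.2 ⟨t, mem_univ _, ht.symm⟩)
      rw [hemb2 β k hk', hf3 k hk']
    rw [h1, Finset.prod_image fun t _ t' _ h => he h]
    exact Finset.prod_congr rfl fun t _ => by rw [hemb1, hf1]
  -- assemble
  symm
  calc ∑ β : Equiv.Perm (Fin r), ∏ t, (MvPolynomial.X (t, β t) : MvPolynomial (Fin r × Fin r) ℂ)
      = ∑ β : Equiv.Perm (Fin r), ∏ i, f (i, emb β i) := Finset.sum_congr rfl fun β _ => (hval β).symm
    _ = ∑ σ ∈ univ.image emb, ∏ i, f (i, σ i) :=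
        (Finset.sum_image (f := fun σ : Equiv.Perm (Fin n) => ∏ i, f (i, σ i)) (s := univ)
          (g := emb) fun β₁ _ β₂ _ h => hemb_inj h).symm
    _ = ∑ σ : Equiv.Perm (Fin n), ∏ i, f (i, σ i) := by
        refine Finset.sum_subset (subset_univ _) fun σ _ hσ => ?_
        by_contra h
        obtain ⟨β, rfl⟩ := key σ h
        exact hσ (mem_image.2 ⟨β, mem_univ _, rfl⟩)

/-- **Matchings with the same permutation labels coincide.**  In a cover of `per_n`, if the variable
labels of two weight-nonzero perfect matchings `τ, τ'` both lie on the graph of one permutation `σ`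
of `Fin n`, then `τ = τ'` (the label-exponent map is injective on weight-nonzero matchings and is
determined by `σ`). -/
theorem eq_of_perm_labels_eq {m n : ℕ} (E : Finset (Fin m × Fin m))
    (a : Fin m × Fin m → MvPolynomial (Fin n × Fin n) ℂ)
    (ha : ∀ e, (∃ j, a e = MvPolynomial.X j) ∨ a e = 0 ∨ a e = 1)
    (hper : Literature.Computability.AlgebraicComplexity.perPoly (Fin n) ℂ =
      MvPolynomial.aeval a (Matrix.of fun i j => if (i, j) ∈ E then MvPolynomial.X (i, j) else 0 :
          Matrix (Fin m) (Fin m) (MvPolynomial (Fin m × Fin m) ℂ)).permanent)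
    (σ : Equiv.Perm (Fin n)) (τ τ' : Equiv.Perm (Fin m))
    (hτ : ∀ i, (i, τ i) ∈ E ∧ a (i, τ i) ≠ 0) (hτ' : ∀ i, (i, τ' i) ∈ E ∧ a (i, τ' i) ≠ 0)
    (hστ : ∀ i j, a (i, τ i) = MvPolynomial.X j → σ j.1 = j.2)
    (hστ' : ∀ i j, a (i, τ' i) = MvPolynomial.X j → σ j.1 = j.2) : τ = τ' := by
  obtain ⟨δ, hδ, -, hδ0⟩ := exists_labels a ha
  set G := univ.filter fun τ : Equiv.Perm (Fin m) => ∀ i, (i, τ i) ∈ E ∧ a (i, τ i) ≠ 0 with hG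
  have hsum : ∑ τ ∈ G, MvPolynomial.monomial (∑ i, δ (i, τ i)) (1 : ℂ) =
      ∑ σ : Equiv.Perm (Fin n), MvPolynomial.monomial (∑ k, Finsupp.single (k, σ k) 1) (1 : ℂ) := by
    rw [← aeval_permanent_cover E a δ hδ G hG, ← hper, perPoly_eq_sum_monomial]
  obtain ⟨hinj, himg, -⟩ := label_bijection G (fun τ => ∑ i, δ (i, τ i))
    (fun σ : Equiv.Perm (Fin n) => ∑ k, Finsupp.single (k, σ k) (1 : ℕ)) pexp_injective hsum
  have hmem : ∀ ρ : Equiv.Perm (Fin m), (∀ i, (i, ρ i) ∈ E ∧ a (i, ρ i) ≠ 0) → ρ ∈ G :=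
    fun ρ hρ => by rw [hG]; exact mem_filter.2 ⟨mem_univ _, hρ⟩
  -- the permutation attached to a weight-nonzero matching by `label_bijection` is `σ`
  have hdet : ∀ ρ : Equiv.Perm (Fin m), (hρ : ∀ i, (i, ρ i) ∈ E ∧ a (i, ρ i) ≠ 0) →
      (∀ i j, a (i, ρ i) = MvPolynomial.X j → σ j.1 = j.2) →
      (∑ i, δ (i, ρ i)) = ∑ k, Finsupp.single (k, σ k) (1 : ℕ) := by
    intro ρ hρ hσρ
    obtain ⟨σ', hσ'⟩ := himg ρ (hmem ρ hρ)
    suffices hσσ : σ' = σ by rw [hσ', hσσ]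
    ext k
    -- the label `x_{k, σ' k}` is carried by some edge of `ρ`
    have h1 : (∑ i, δ (i, ρ i)) (k, σ' k) = 1 := by
      rw [hσ', pexp_apply, if_pos rfl]
    rw [Finsupp.finsetSum_apply] at h1
    obtain ⟨i, -, hi⟩ := Finset.exists_ne_zero_of_sum_ne_zero (by rw [h1]; exact one_ne_zero)
    have hv : ∃ j, a (i, ρ i) = MvPolynomial.X j := by
      by_contra hv
      rw [hδ0 _ hv] at hi
      exact hi rfl
    obtain ⟨j, hj⟩ := hv
    have h2 := hδ (i, ρ i) (hρ i).2
    rw [hj] at h2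
    have h3 : δ (i, ρ i) = Finsupp.single j 1 :=
      (MvPolynomial.monomial_left_injective (one_ne_zero' ℂ) h2).symm
    rw [h3, Finsupp.single_apply] at hi
    have hjk : j = (k, σ' k) := by by_contra h; exact hi (if_neg h)
    have := hσρ i j hj
    rw [hjk] at this
    exact congrArg Fin.val this.symm
  exact hinj τ (hmem τ hτ) τ' (hmem τ' hτ') ((hdet τ hτ hστ).trans (hdet τ' hτ' hστ').symm)

/-- The substitution of `aeval_perPoly_specialize` exists (explicit formula: a double sum of
indicator-weighted variables on the rows `e t`, an indicator on the other rows). -/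
theorem exists_laplace_specialization {n r : ℕ} (e : Fin r → Fin n) (he : Function.Injective e)
    (σ₀ : Equiv.Perm (Fin n)) :
    ∃ f : Fin n × Fin n → MvPolynomial (Fin r × Fin r) ℂ,
      (∀ t t', f (e t, σ₀ (e t')) = MvPolynomial.X (t, t')) ∧
      (∀ t l, (∀ t', l ≠ σ₀ (e t')) → f (e t, l) = 0) ∧
      (∀ k, (∀ t, k ≠ e t) → f (k, σ₀ k) = 1) ∧
      (∀ k l, (∀ t, k ≠ e t) → l ≠ σ₀ k → f (k, l) = 0) := by
  refine ⟨fun kl => (∑ t : Fin r, ∑ t' : Fin r,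
      if kl.1 = e t ∧ kl.2 = σ₀ (e t') then MvPolynomial.X (t, t') else 0) +
      (if (∀ t, kl.1 ≠ e t) ∧ kl.2 = σ₀ kl.1 then 1 else 0), ?_, ?_, ?_, ?_⟩
  · intro t t'
    dsimp only
    rw [if_neg (fun h => h.1 t rfl), add_zero, Finset.sum_eq_single t, Finset.sum_eq_single t',
      if_pos ⟨rfl, rfl⟩]
    · intro t₁ _ ht₁
      rw [if_neg]
      rintro ⟨-, h⟩
      exact ht₁ (he (σ₀.injective h)).symm
    · intro h; exact absurd (mem_univ _) h
    · intro t₁ _ ht₁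
      refine Finset.sum_eq_zero fun t₂ _ => ?_
      rw [if_neg]
      rintro ⟨h, -⟩
      exact ht₁ (he h).symm
    · intro h; exact absurd (mem_univ _) h
  · intro t l hl
    dsimp only
    rw [if_neg (fun h => h.1 t rfl), add_zero]
    refine Finset.sum_eq_zero fun t₁ _ => Finset.sum_eq_zero fun t₂ _ => ?_
    rw [if_neg]
    rintro ⟨-, h⟩
    exact hl t₂ h
  · intro k hk
    dsimp only
    rw [if_pos ⟨hk, rfl⟩, Finset.sum_eq_zero fun t₁ _ => Finset.sum_eq_zero fun t₂ _ => ?_,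
      zero_add]
    rw [if_neg]
    rintro ⟨h, -⟩
    exact hk t₁ h
  · intro k l hk hl
    dsimp only
    rw [if_neg (fun h => hl h.2), add_zero]
    refine Finset.sum_eq_zero fun t₁ _ => Finset.sum_eq_zero fun t₂ _ => ?_
    rw [if_neg]
    rintro ⟨h, -⟩
    exact hk t₁ h

end Summit.ValiantsHypothesis.ValiantsHypothesis.Theorems.PolyaContinuedMonotoneCoverHard
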